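/-
Copyright: the b2b-balaban cell (near-miss cell 7), T⁴-continuum fan-out; row NE7b ROUND-2 swarm, seat
t4-ne7b-formalise-leaf-10 (gen 3; sub-rows S6g′(e)∕(f) of `t4/b2b-balaban-t4-ne7b-p1/LEAVES-NE7b.md`, owner's ruling
R-OWNER-22-12 (2)).  Released under the licence of the surrounding project.
-/
import Summits.QuantumFields.BalabanUV.T4Continuum.Support.HistoryJoinsClass
import Summits.QuantumFields.BalabanUV.T4Continuum.Support.HistorySiblingEntropy

/-!
# The per-join factor of the binding in ENTROPY FORM: `jfac ≤ exp(2(r−1) + Z + logMultinomial) · ∏ NZ` — no rank,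
# no fibre display (row S6g′(e) × binding pt 5)

Summits-side support leaf of the T⁴-continuum cell (rung (B)+1 on a FINITE torus only; NOT infinite volume, NOT the
mass gap, NOT the Clay statement; NOT a proof of the spine estimate NE7b).  Row NE7b, route «COUNT», row S6g′
«MASS-BASED SIBLING COUNT» (R-OWNER-22-12 (2)).  [folklore] real arithmetic over leaf-05 gen 2's binding
(`HistoryJoinsTotal.jfac`, `HistoryJoinsClass.csize`∕`symFac_eq_prod`∕`sum_csize`) and this lineage's
`HistorySiblingEntropy.classes_cost_le`; nothing is quoted from print, nothing printed is asserted, no `[cite:]` tag,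
no `Prop` fact minted.

WHY.  `HistoryJoinsClass.jfac_le_exp` bounds the per-join factor `jfac = Z^{r−1}·∏_{i≠h} NZ_i ∕ symFac`
(`Z = Σ_j M t (part j)`) through a DISPLAYED rank and the DISPLAYED rank-fibre hypothesis `hfib`.  The exact split of
`HistorySiblingEntropy` gives the same factor WITHOUT any display: since `symFac = ∏_j (csize j)!` and `Σ_j csize j =
r − 1`, `log(Z^{r−1}∕symFac) = Σ_j (csize_j·log Z − log csize_j!) ≤ 2(r−1) + Z + logMultinomial univ csize`
(`classes_cost_le`), i.e. **`jfac ≤ exp(2(r−1) + Z + logMultinomial univ (csize …)) · ∏_{i≠h} NZ_i`** — the residual of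
the join is its log-multinomial (the SIBLING ENTROPY of the join), to be telescoped along `jW` (pt 6) into the display
`Σ_{q ∈ croots} logMultinomial … ≤ θ_e·bsum (fat+1) + λ_e·partnerAges + A_e·gsize` (typer ACCEPT-A12I v1.5 (3)),
which `HistorySiblingEntropyBound.ent_le_two_mul_phi` discharges for canonically ordered join lists through the bridge
`jparts ↦ Shape` (sub-row S6g′(f)).

WHAT.  `log_pow_div_symFac_eq` (the exact split in the binding's letters), **`jfac_le_exp_logMultinomial`**, and the
rank road recovered as a corollary shape (`logMultinomial univ csize ≤ …` is `HistorySiblingEntropy.logMultinomial_le_*`).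

HONEST SCOPE.  Arithmetic only; NE7b NOT proved.  HONEST DEPENDENCY (cell): continuum YM on T⁴ ⇐ BetaPertH ∧ nine spine
estimates (0/9 proved); BetaPertH ⇐ (D1) ∧ (D4) ∧ CAP+tail; G-an2-4 gates asym, D1 and NE2/3/4.  This file changes none
of it.
-/

open Finset
open Literature.MathematicalPhysics.QuantumFieldTheory.Balaban1983to89
open T4PersistenceDictionary T4PartnerMultiplicity T4BranchingRecordsGas
open Summit.QuantumFields.BalabanUV.T4Continuum.HistoryJoins
open Summit.QuantumFields.BalabanUV.T4Continuum.HistoryJoinsAdm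
open Summit.QuantumFields.BalabanUV.T4Continuum.HistoryJoinsCount
open Summit.QuantumFields.BalabanUV.T4Continuum.HistoryJoinsTotal
open Summit.QuantumFields.BalabanUV.T4Continuum.HistoryJoinsClass
open Summit.QuantumFields.BalabanUV.T4Continuum.HistorySiblingEntropy

namespace Summit.QuantumFields.BalabanUV.T4Continuum.HistorySiblingEntropyJfac

noncomputable section

open scoped Classical

variable {ε : Type*} (st : ε → ℕ) (X Y : Gen ε) (e : ε)

/-- **THE EXACT SPLIT IN THE BINDING'S LETTERS**: for `Z > 0`,
`log (Z^{r−1} ∕ symFac) = ((r−1)·log Z − log (r−1)!) + logMultinomial univ csize`. [folklore] -/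
theorem log_pow_div_symFac_eq {Z : ℝ} (hZ : 0 < Z) :
    Real.log (Z ^ (npart st (Gen.merge X Y e) - 1) / symFac st X Y e) =
      (((npart st (Gen.merge X Y e) - 1 : ℕ) : ℝ) * Real.log Z -
          Real.log ((npart st (Gen.merge X Y e) - 1).factorial : ℝ)) +
        logMultinomial univ (csize st X Y e) := by
  have hsym : Real.log (symFac st X Y e) = ∑ j, Real.log (((csize st X Y e j).factorial : ℕ) : ℝ) := by
    rw [symFac_eq_prod, Real.log_prod]
    exact fun j _ => by exact_mod_cast (Nat.factorial_pos _).ne'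
  rw [Real.log_div (pow_pos hZ _).ne' (symFac_pos st X Y e).ne', Real.log_pow, hsym]
  have hsplit := classes_cost_eq (univ : Finset (Fin (npart st (Gen.merge X Y e)))) (csize st X Y e) Z
  rw [sum_csize] at hsplit
  rw [sum_sub_distrib, ← sum_mul] at hsplit
  have hcast : ∑ j, (csize st X Y e j : ℝ) = ((npart st (Gen.merge X Y e) - 1 : ℕ) : ℝ) := by
    rw [← Nat.cast_sum, sum_csize]
  rw [hcast] at hsplit
  linarith

/-- **THE PER-JOIN FACTOR IN ENTROPY FORM**:
`jfac ≤ exp(2(r−1) + Σ_j M t (part j) + logMultinomial univ csize) · ∏_{i≠h} NZ_i` — NO rank, NO fibre hypothesis.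
[folklore] -/
theorem jfac_le_exp_logMultinomial (M : ℕ → Gen ε → ℕ) (ext : ℕ → Gen ε → ℝ) (NZ : ℝ → ℕ → ℕ → ℕ) :
    jfac st M ext NZ X Y e ≤
      Real.exp (2 * (((npart st (Gen.merge X Y e) - 1 : ℕ) : ℝ)) +
          (∑ j, (M (st e) (part st (Gen.merge X Y e) j).2 : ℝ)) + logMultinomial univ (csize st X Y e)) *
        ∏ i : {i // i ≠ hostIdx st X Y e},
          (NZ (ext (st e) (part st (Gen.merge X Y e) i.1).2) (st e) (part st _ i.1).2.rootStep : ℝ) := by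
  set n := npart st (Gen.merge X Y e) with hn
  set Z : ℝ := ∑ j, (M (st e) (part st (Gen.merge X Y e) j).2 : ℝ) with hZdef
  have hZ0 : 0 ≤ Z := sum_nonneg fun _ _ => Nat.cast_nonneg _
  have hNZ0 : 0 ≤ ∏ i : {i // i ≠ hostIdx st X Y e},
      (NZ (ext (st e) (part st (Gen.merge X Y e) i.1).2) (st e) (part st _ i.1).2.rootStep : ℝ) :=
    prod_nonneg fun _ _ => Nat.cast_nonneg _
  have hn2 : 2 ≤ n := by
    have h := jparts_merge st X Y e
    have h1 := one_le_length_clusterParts st (st e) X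
    have h2 := one_le_length_clusterParts st (st e) Y
    have : (jparts st (Gen.merge X Y e)).length = (clusterParts st (st e) X).length + (clusterParts st (st e) Y).length := by
      rw [h, List.length_append, List.length_map, List.length_map]
    simp only [hn, npart]; omega
  have hjfac : jfac st M ext NZ X Y e = (Z ^ (n - 1) / symFac st X Y e) *
      ∏ i : {i // i ≠ hostIdx st X Y e},
        (NZ (ext (st e) (part st (Gen.merge X Y e) i.1).2) (st e) (part st _ i.1).2.rootStep : ℝ) := by
    unfold jfac; ring
  rw [hjfac]
  refine mul_le_mul_of_nonneg_right ?_ hNZ0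
  rcases hZ0.eq_or_lt with hz | hz
  · -- `Z = 0`: the factor vanishes (`r − 1 ≥ 1`)
    rw [← hz, zero_pow (by omega), zero_div]
    exact (Real.exp_pos _).le
  · have hpos : 0 < Z ^ (n - 1) / symFac st X Y e := div_pos (pow_pos hz _) (symFac_pos st X Y e)
    rw [← Real.exp_log hpos, Real.exp_le_exp, log_pow_div_symFac_eq st X Y e hz]
    have h1 := one_class_cost_le (n - 1) hz.le
    linarith

end

end Summit.QuantumFields.BalabanUV.T4Continuum.HistorySiblingEntropyJfac
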